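import Mathlib
import HarnessLib
import Literature.MathematicalPhysics.QuantumLattice.GaugeGroups
import Literature.MathematicalPhysics.QuantumFieldTheory.ConstructiveQFTWave0
import Literature.MathematicalPhysics.QuantumFieldTheory.U1GinibreComparison
import Summits.Ventures.LatticeQCDFlow.Exactness.CompactHaar
import Summits.Ventures.LatticeQCDFlow.Scaling.HaarConvolutionRatio
import Summits.Ventures.LatticeQCDFlow.Scaling.PlaquetteMarginals2D
import Summits.Ventures.LatticeQCDFlow.Scaling.LatticePeeling
import Summits.Ventures.LatticeQCDFlow.Scaling.FluxTunnellingU1Explicit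
import Summits.Ventures.LatticeQCDFlow.Scaling.HaarConvolutionPower

/-!
# Convolution powers of the `U(1)` Wilson weight: the COMPENSATION lower bound and the two-sided level

HONEST FRAMING: exact (Metropolis-corrected) sampling algorithms for lattice gauge theory;
figures of merit are autocorrelation/cost numbers at stated couplings and volumes; no
continuum-physics claim.

Venture `LatticeQCDFlow` (cell pub-lqcd), topic `Scaling`, FANOUT row 29 (theory2, gen-20), item 101b.
NEW WORK over Mathlib, lean-1's `Scaling/HaarConvolutionRatio` + `Scaling/PlaquetteMarginals2D` (row 30)
and item 101a `Scaling/HaarConvolutionPower` (product-integral form `iterate_eq_lintegral_pi`, pairing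
inequality `two_mul_exp_le_pair`); nothing here is cited as a fact.

lean-1's `iterate_odd_apply_le` bounds the Haar-convolution powers `K_wᵐ w` of a symmetric weight
from ABOVE by their value at the identity (odd `m`, Cauchy–Schwarz).  For the `U(1)` Wilson weight
`w_β(g) = e^{−β(1 − Re g)}` (`u1W`, the one `def`: the weight as a named `ℝ≥0∞`-valued function, with
`z1_eq_lintegral_u1W : z₁(β) = ∫ w_β dHaar`) this file gives the matching bound from BELOW, with NO
harmonic analysis:

* §3 **`iterate_apply_pow_ge`** — COMPENSATION: for `β ≥ 0`, every `m` and every `c ∈ U(1)`,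
  `e^{−β(m+1)(1 − Re c)}·(K_wᵐ w)(1) ≤ (K_wᵐ w)(c^{m+1})`: distributing a total twist `c^{m+1}`
  evenly over the `m + 1` factors and pairing each shifted configuration with its complex conjugate
  (Haar measure on `U(1)^m` is translation and inversion invariant; `two_mul_prod_u1W_le`) costs at
  most the action of the UNIFORM distribution; hence **`iterate_apply_ge`**:
  `e^{−β(m+1)(1 − cos(π/(m+1)))}·(K_wᵐ w)(1) ≤ (K_wᵐ w)(u)` for every `u` — a closing constraint of
  total angle `≤ π` spread over `m + 1` plaquettes costs `≈ e^{−βπ²/(2(m+1))}`, NOT `e^{−2β}`;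
* §4 **`iterate_two_sided`** — for `m ≥ 1` (both parities) an explicit level `s` with
  `K_wᵐ w ≤ s` and `e^{−β(m+1)(1 − cos(π/m))}·s ≤ K_wᵐ w` everywhere (odd `m`: `s = (K_wᵐ w)(1)` by
  lean-1's peak-at-identity; even `m`: one factor `z₁` split off; `exp_comp_mono`).

This is the volume-uniform input of the sharp tunnelling floor (items 102–104): after lean-1's
puncture, the 2-d Wilson measure of a patch event differs from the product of one-plaquette laws by
the closing factor `(K_w^{L²−1−N} w)(∏_P U_x)`, and §4 pins it between two constants whose ratio
tends to ONE as the volume grows.  Elementary.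
-/

noncomputable section

namespace Summit.Ventures.LatticeQCDFlow.Theory2.HaarConv

open MeasureTheory Real
open Literature.MathematicalPhysics.QuantumFieldTheory Literature.MathematicalPhysics.QuantumLattice
open scoped ENNReal

/-! ## §3 The `U(1)` Wilson weight and the compensation bound -/

/-- The one-plaquette `U(1)` Wilson weight `w_β(g) = e^{−β(1 − Re g)}` in `ℝ≥0∞` (lean-1's
spelling, so that `Lattice.z1 u1Rep β = ∫ w_β dHaar` definitionally). [folklore] -/
def u1W (β : ℝ) : Circle → ℝ≥0∞ :=
  fun g => ENNReal.ofReal (Real.exp (-(β * (((1 : ℕ) : ℝ) - (u1Rep g).trace.re))))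

/-- `w_β(g) = e^{−β(1 − Re g)}`. [folklore] -/
theorem u1W_apply (β : ℝ) (g : Circle) :
    u1W β g = ENNReal.ofReal (Real.exp (-(β * (1 - ((g : Circle) : ℂ).re)))) := by
  simp [u1W]

/-- `z₁(β) = ∫ w_β dHaar`. [folklore] -/
theorem z1_eq_lintegral_u1W (β : ℝ) : Lattice.z1 u1Rep β = ∫⁻ g, u1W β g ∂(haarProbability Circle) := rfl

/-- `w_β` is measurable. [folklore] -/
theorem measurable_u1W (β : ℝ) : Measurable (u1W β) :=
  Lattice.TwoDim.measurable_oneWeight u1Rep continuous_u1Rep β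

/-- `w_β` is symmetric. [folklore] -/
theorem u1W_symm (β : ℝ) (g : Circle) : u1W β g⁻¹ = u1W β g := Lattice.TwoDim.u1_weight_symm β g

/-- `w_β` vanishes nowhere. [folklore] -/
theorem u1W_ne_zero (β : ℝ) (g : Circle) : u1W β g ≠ 0 := Lattice.TwoDim.u1_weight_ne_zero β g

/-- `w_β ≤ 1` for `β ≥ 0`. [folklore] -/
theorem u1W_le_one {β : ℝ} (hβ : 0 ≤ β) (g : Circle) : u1W β g ≤ 1 :=
  Lattice.TwoDim.u1_weight_le_one hβ g

/-- `0 < z₁(β)`. [folklore] -/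
theorem z1_u1_ne_zero (β : ℝ) : Lattice.z1 u1Rep β ≠ 0 := by
  rw [z1_eq_lintegral_u1W]
  intro h
  have hae := (lintegral_eq_zero_iff (measurable_u1W β)).mp h
  obtain ⟨g, hg⟩ := hae.exists
  exact u1W_ne_zero β g hg

/-- `z₁(β) ≤ 1` for `β ≥ 0`. [folklore] -/
theorem z1_u1_le_one {β : ℝ} (hβ : 0 ≤ β) : Lattice.z1 u1Rep β ≤ 1 := by
  rw [z1_eq_lintegral_u1W]
  calc ∫⁻ g, u1W β g ∂(haarProbability Circle) ≤ ∫⁻ _, 1 ∂(haarProbability Circle) :=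
        lintegral_mono fun g => u1W_le_one hβ g
    _ = 1 := by rw [lintegral_one, measure_univ]

/-- Real parts on the circle are `≤ 1`. [folklore] -/
theorem circle_re_le_one (z : Circle) : ((z : Circle) : ℂ).re ≤ 1 :=
  (Complex.re_le_norm _).trans_eq (Circle.norm_coe z)

/-- `Re(c z) = Re c·Re z − Im c·Im z`, `Re(c⁻¹ z) = Re c·Re z + Im c·Im z`. [folklore] -/
theorem circle_re_mul (c z : Circle) :
    ((c * z : Circle) : ℂ).re = (c : ℂ).re * (z : ℂ).re - (c : ℂ).im * (z : ℂ).im ∧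
    ((c⁻¹ * z : Circle) : ℂ).re = (c : ℂ).re * (z : ℂ).re + (c : ℂ).im * (z : ℂ).im := by
  refine ⟨by rw [Circle.coe_mul, Complex.mul_re], ?_⟩
  rw [Circle.coe_mul, Circle.coe_inv_eq_conj, Complex.mul_re, Complex.conj_re, Complex.conj_im]
  ring

/-- The pairing inequality for the weights of a family `ζ : ι → U(1)` twisted by `c^{∓1}`:
`2·e^{−β·#ι·(1 − Re c)}·∏ⱼ w(ζⱼ) ≤ ∏ⱼ w(c⁻¹ζⱼ) + ∏ⱼ w(cζⱼ)`. [folklore] -/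
theorem two_mul_prod_u1W_le {ι : Type*} [Fintype ι] {β : ℝ} (hβ : 0 ≤ β) (c : Circle)
    (ζ : ι → Circle) :
    2 * (ENNReal.ofReal (Real.exp (-(β * ((Fintype.card ι : ℝ) * (1 - (c : ℂ).re))))) *
        ∏ j, u1W β (ζ j)) ≤
      ∏ j, u1W β (c⁻¹ * ζ j) + ∏ j, u1W β (c * ζ j) := by
  simp only [u1W_apply]
  have hmul : ∀ j, ((c * ζ j : Circle) : ℂ).re = (c : ℂ).re * (ζ j : ℂ).re - (c : ℂ).im * (ζ j : ℂ).im :=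
    fun j => (circle_re_mul c (ζ j)).1
  have hinv : ∀ j, ((c⁻¹ * ζ j : Circle) : ℂ).re = (c : ℂ).re * (ζ j : ℂ).re + (c : ℂ).im * (ζ j : ℂ).im :=
    fun j => (circle_re_mul c (ζ j)).2
  simp only [hmul, hinv]
  rw [← ENNReal.ofReal_prod_of_nonneg (fun _ _ => (Real.exp_pos _).le),
    ← ENNReal.ofReal_prod_of_nonneg (fun _ _ => (Real.exp_pos _).le),
    ← ENNReal.ofReal_prod_of_nonneg (fun _ _ => (Real.exp_pos _).le),
    ← ENNReal.ofReal_mul (Real.exp_pos _).le, ← ENNReal.ofReal_ofNat,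
    ← ENNReal.ofReal_mul (by norm_num : (0 : ℝ) ≤ 2),
    ← ENNReal.ofReal_add (Finset.prod_nonneg fun _ _ => (Real.exp_pos _).le)
      (Finset.prod_nonneg fun _ _ => (Real.exp_pos _).le)]
  exact ENNReal.ofReal_le_ofReal (two_mul_exp_le_pair (fun j => ((ζ j : Circle) : ℂ).re)
    (fun j => ((ζ j : Circle) : ℂ).im) hβ (circle_re_le_one c) (fun j => circle_re_le_one (ζ j)))

/-- Powers of `Circle.exp`: `(exp t)ⁿ = exp (n·t)`. [folklore] -/
theorem circleExp_pow (t : ℝ) (n : ℕ) : Circle.exp t ^ n = Circle.exp (n * t) := by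
  induction n with
  | zero => simp
  | succ n ih => rw [pow_succ, ih, ← Circle.exp_add]; congr 1; push_cast; ring

/-- **COMPENSATION.**  For `β ≥ 0`, every `m` and every `c ∈ U(1)`:
`e^{−β(m+1)(1 − Re c)}·(K_wᵐ w)(1) ≤ (K_wᵐ w)(c^{m+1})`. [folklore] -/
theorem iterate_apply_pow_ge {β : ℝ} (hβ : 0 ≤ β) (m : ℕ) (c : Circle) :
    ENNReal.ofReal (Real.exp (-(β * ((m + 1 : ℝ) * (1 - (c : ℂ).re))))) *
        (haarConv (u1W β))^[m] (u1W β) 1 ≤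
      (haarConv (u1W β))^[m] (u1W β) (c ^ (m + 1)) := by
  have hw := measurable_u1W β
  set μ : Measure (Fin m → Circle) := Measure.pi fun _ : Fin m => haarProbability Circle with hμ
  rw [iterate_eq_lintegral_pi hw hw m 1, iterate_eq_lintegral_pi hw hw m (c ^ (m + 1))]
  simp only [one_mul]
  -- the three integrands: untwisted, twisted by `c⁻¹`, twisted by `c`
  let ζ : (Fin m → Circle) → Fin (m + 1) → Circle := fun h => Fin.cons (∏ i, h i)⁻¹ h
  let F₀ : (Fin m → Circle) → ℝ≥0∞ := fun h => ∏ j, u1W β (ζ h j)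
  let F₁ : (Fin m → Circle) → ℝ≥0∞ := fun h => ∏ j, u1W β (c⁻¹ * ζ h j)
  let F₂ : (Fin m → Circle) → ℝ≥0∞ := fun h => ∏ j, u1W β (c * ζ h j)
  have hprod : Measurable fun h : Fin m → Circle => ∏ i, h i :=
    Finset.measurable_prod _ fun i _ => measurable_pi_apply i
  have hζm : ∀ j, Measurable fun h : Fin m → Circle => ζ h j := by
    intro j
    refine Fin.cases ?_ (fun i => ?_) j
    · simp only [ζ, Fin.cons_zero]; exact hprod.inv
    · simpa [ζ] using measurable_pi_apply i
  have hF₁m : Measurable F₁ :=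
    Finset.measurable_prod _ fun j _ => hw.comp ((hζm j).const_mul c⁻¹)
  have hF₂m : Measurable F₂ :=
    Finset.measurable_prod _ fun j _ => hw.comp ((hζm j).const_mul c)
  -- (a) the untwisted integrand is `F₀`
  have h0 : ∀ h : Fin m → Circle, u1W β (∏ i, h i) * ∏ i, u1W β (h i) = F₀ h := by
    intro h
    simp only [F₀, ζ, Fin.prod_univ_succ, Fin.cons_zero, Fin.cons_succ, u1W_symm]
  -- (b) after the shift `h ↦ h·c⁻¹` the twisted integrand is `F₁`
  have hshift : ∫⁻ h, u1W β (c ^ (m + 1) * ∏ i, h i) * ∏ i, u1W β (h i) ∂μ = ∫⁻ h, F₁ h ∂μ := by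
    rw [← lintegral_mul_right_eq_self
      (fun h : Fin m → Circle => u1W β (c ^ (m + 1) * ∏ i, h i) * ∏ i, u1W β (h i))
      (fun _ : Fin m => c⁻¹)]
    refine lintegral_congr fun h => ?_
    simp only [Pi.mul_apply]
    have hp : ∏ x, h x * c⁻¹ = (∏ i, h i) * (c ^ m)⁻¹ := by
      rw [Finset.prod_mul_distrib, Finset.prod_const, Finset.card_univ, Fintype.card_fin, inv_pow]
    have hc : c ^ (m + 1) * ((∏ i, h i) * (c ^ m)⁻¹) = c * ∏ i, h i := by
      rw [mul_comm (∏ i, h i), ← mul_assoc, pow_succ', mul_assoc c, mul_inv_cancel, mul_one]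
    have hfirst : u1W β (c * ∏ i, h i) = u1W β (c⁻¹ * (∏ i, h i)⁻¹) := by
      rw [← u1W_symm β (c * ∏ i, h i), mul_inv]
    have hq : ∏ x, u1W β (h x * c⁻¹) = ∏ x, u1W β (c⁻¹ * h x) :=
      Finset.prod_congr rfl fun x _ => by rw [mul_comm]
    rw [hp, hc, hfirst, hq]
    simp only [F₁, ζ, Fin.prod_univ_succ, Fin.cons_zero, Fin.cons_succ]
  -- (c) inversion turns `F₁` into `F₂`
  have hinv : ∫⁻ h, F₁ h ∂μ = ∫⁻ h, F₂ h ∂μ := by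
    rw [← lintegral_inv_eq_self (μ := μ) F₁]
    refine lintegral_congr fun h => ?_
    have hz : ∀ j, ζ h⁻¹ j = (ζ h j)⁻¹ := by
      intro j
      refine Fin.cases ?_ (fun i => ?_) j
      · simp [ζ, Finset.prod_inv_distrib]
      · simp [ζ]
    simp only [F₁, F₂, hz]
    refine Finset.prod_congr rfl fun j _ => ?_
    rw [← u1W_symm β (c⁻¹ * (ζ h j)⁻¹), mul_inv, inv_inv, inv_inv]
  -- (d) pair and compare pointwise
  have hpair : ∀ h, 2 * (ENNReal.ofReal (Real.exp (-(β * ((m + 1 : ℝ) * (1 - (c : ℂ).re))))) * F₀ h) ≤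
      F₁ h + F₂ h := by
    intro h
    have := two_mul_prod_u1W_le (ι := Fin (m + 1)) hβ c (ζ h)
    simpa [Fintype.card_fin] using this
  have key : 2 * (ENNReal.ofReal (Real.exp (-(β * ((m + 1 : ℝ) * (1 - (c : ℂ).re))))) *
      ∫⁻ h, F₀ h ∂μ) ≤ 2 * ∫⁻ h, F₁ h ∂μ := by
    calc 2 * (ENNReal.ofReal (Real.exp (-(β * ((m + 1 : ℝ) * (1 - (c : ℂ).re))))) * ∫⁻ h, F₀ h ∂μ)
        = ∫⁻ h, 2 * (ENNReal.ofReal (Real.exp (-(β * ((m + 1 : ℝ) * (1 - (c : ℂ).re))))) * F₀ h) ∂μ := by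
          rw [← lintegral_const_mul' _ _ ENNReal.ofReal_ne_top, ← lintegral_const_mul' _ _ (by norm_num)]
      _ ≤ ∫⁻ h, F₁ h + F₂ h ∂μ := lintegral_mono hpair
      _ = ∫⁻ h, F₁ h ∂μ + ∫⁻ h, F₂ h ∂μ := lintegral_add_left hF₁m _
      _ = 2 * ∫⁻ h, F₁ h ∂μ := by rw [hinv, two_mul]
  simp_rw [h0]
  rw [hshift]
  exact (ENNReal.mul_le_mul_iff_right (by simp) (by simp)).mp key

/-- **COMPENSATION, ANGULAR FORM.**  For `β ≥ 0`, every `m` and EVERY `u ∈ U(1)`: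
`e^{−β(m+1)(1 − cos(π/(m+1)))}·(K_wᵐ w)(1) ≤ (K_wᵐ w)(u)` — a closing twist of angle `≤ π` spread
over `m + 1` plaquettes. [folklore] -/
theorem iterate_apply_ge {β : ℝ} (hβ : 0 ≤ β) (m : ℕ) (u : Circle) :
    ENNReal.ofReal (Real.exp (-(β * ((m + 1 : ℝ) * (1 - Real.cos (π / (m + 1))))))) *
        (haarConv (u1W β))^[m] (u1W β) 1 ≤
      (haarConv (u1W β))^[m] (u1W β) u := by
  set θ : ℝ := Complex.arg (u : ℂ) with hθ
  have hM : (0 : ℝ) < m + 1 := by positivity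
  set c : Circle := Circle.exp (θ / (m + 1)) with hc
  have hcu : c ^ (m + 1) = u := by
    have hmul : ((m + 1 : ℕ) : ℝ) * (θ / (m + 1)) = θ := by
      rw [Nat.cast_succ]; exact mul_div_cancel₀ θ hM.ne'
    rw [hc, circleExp_pow, hmul]
    exact Circle.exp_arg u
  have hre : (c : ℂ).re = Real.cos (θ / (m + 1)) := by
    rw [hc, Circle.coe_exp, Complex.exp_ofReal_mul_I_re]
  have hcos : Real.cos (π / (m + 1)) ≤ (c : ℂ).re := by
    rw [hre, ← Real.cos_abs (θ / (m + 1))]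
    refine Real.cos_le_cos_of_nonneg_of_le_pi (abs_nonneg _) ?_ ?_
    · exact div_le_self Real.pi_pos.le (by linarith)
    · rw [abs_div, abs_of_pos hM]
      exact div_le_div_of_nonneg_right (Complex.abs_arg_le_pi _) hM.le
  calc ENNReal.ofReal (Real.exp (-(β * ((m + 1 : ℝ) * (1 - Real.cos (π / (m + 1))))))) *
        (haarConv (u1W β))^[m] (u1W β) 1
      ≤ ENNReal.ofReal (Real.exp (-(β * ((m + 1 : ℝ) * (1 - (c : ℂ).re))))) *
          (haarConv (u1W β))^[m] (u1W β) 1 :=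
        mul_le_mul_left (ENNReal.ofReal_le_ofReal (Real.exp_le_exp.mpr (neg_le_neg
          (mul_le_mul_of_nonneg_left (mul_le_mul_of_nonneg_left (by linarith) hM.le) hβ)))) _
    _ ≤ (haarConv (u1W β))^[m] (u1W β) (c ^ (m + 1)) := iterate_apply_pow_ge hβ m c
    _ = _ := by rw [hcu]

/-! ## §4 The two-sided level (both parities) -/

/-- The compensation factor decreases in the angle budget: for `1 ≤ m ≤ M`,
`e^{−βA(1 − cos(π/m))} ≤ e^{−βA(1 − cos(π/M))}` (`A, β ≥ 0`). [folklore] -/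
theorem exp_comp_mono {β A : ℝ} (hβ : 0 ≤ β) (hA : 0 ≤ A) {m M : ℝ} (hm : 1 ≤ m) (hmM : m ≤ M) :
    Real.exp (-(β * (A * (1 - Real.cos (π / m))))) ≤ Real.exp (-(β * (A * (1 - Real.cos (π / M))))) := by
  have hmpos : 0 < m := by linarith
  have hMpos : 0 < M := by linarith
  have hcos : Real.cos (π / m) ≤ Real.cos (π / M) := by
    refine Real.cos_le_cos_of_nonneg_of_le_pi (by positivity) ?_ ?_
    · exact div_le_self Real.pi_pos.le hm
    · exact div_le_div_of_nonneg_left Real.pi_pos.le hmpos hmM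
  refine Real.exp_le_exp.mpr (neg_le_neg (mul_le_mul_of_nonneg_left ?_ hβ))
  exact mul_le_mul_of_nonneg_left (by linarith) hA

/-- **TWO-SIDED LEVEL.**  For `β ≥ 0` and `m ≥ 1` there is a level `0 < s ≤ 1` with
`(K_wᵐ w)(u) ≤ s` and `e^{−β(m+1)(1 − cos(π/m))}·s ≤ (K_wᵐ w)(u)` for every `u` (odd `m`:
`s = (K_wᵐ w)(1)`, lean-1's peak at the identity; even `m`: `s = z₁·(K_w^{m−1} w)(1)`). [folklore] -/
theorem iterate_two_sided {β : ℝ} (hβ : 0 ≤ β) {m : ℕ} (hm : 1 ≤ m) :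
    ∃ s : ℝ≥0∞, s ≠ 0 ∧ s ≤ 1 ∧ (∀ u, (haarConv (u1W β))^[m] (u1W β) u ≤ s) ∧
      ∀ u, ENNReal.ofReal (Real.exp (-(β * ((m + 1 : ℝ) * (1 - Real.cos (π / m)))))) * s ≤
        (haarConv (u1W β))^[m] (u1W β) u := by
  have hw := measurable_u1W β
  have hws := u1W_symm β
  have hw0 := u1W_ne_zero β
  have hw1 := u1W_le_one hβ
  have hm1 : (1 : ℝ) ≤ m := by exact_mod_cast hm
  obtain ⟨i, hi | hi⟩ := Nat.even_or_odd' m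
  · -- even `m = 2i`, `i ≥ 1`: `m = (2j+1) + 1`
    obtain ⟨j, rfl⟩ : ∃ j, i = j + 1 := ⟨i - 1, by omega⟩
    have hm' : m = 2 * j + 1 + 1 := by omega
    have hKs : (haarConv (u1W β))^[m] (u1W β) =
        haarConv (u1W β) ((haarConv (u1W β))^[2 * j + 1] (u1W β)) := by
      rw [hm', Function.iterate_succ_apply']
    refine ⟨(haarConv (u1W β))^[2 * j + 1] (u1W β) 1 * Lattice.z1 u1Rep β,
      mul_ne_zero (iterate_apply_ne_zero hw hw0 _ _) (z1_u1_ne_zero β), ?_, ?_, ?_⟩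
    · calc (haarConv (u1W β))^[2 * j + 1] (u1W β) 1 * Lattice.z1 u1Rep β ≤ 1 * 1 :=
            mul_le_mul' (iterate_apply_le_one hw hw1 _ _) (z1_u1_le_one hβ)
        _ = 1 := one_mul _
    · intro u
      rw [show m = 1 + (2 * j + 1) by omega, z1_eq_lintegral_u1W,
        ← pow_one (∫⁻ g, u1W β g ∂(haarProbability Circle))]
      exact iterate_apply_le_pow_mul hw hws j 1 u
    · intro u
      rw [hKs]
      have hρ : ∀ g, ENNReal.ofReal (Real.exp (-(β * ((m + 1 : ℝ) * (1 - Real.cos (π / m)))))) *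
          (haarConv (u1W β))^[2 * j + 1] (u1W β) 1 ≤
            (haarConv (u1W β))^[2 * j + 1] (u1W β) (u * g) := by
        intro g
        refine le_trans (mul_le_mul_left (ENNReal.ofReal_le_ofReal ?_) _)
          (iterate_apply_ge hβ (2 * j + 1) (u * g))
        have h2 : ((2 * j + 1 : ℕ) : ℝ) + 1 = m := by rw [hm']; push_cast; ring
        rw [h2]
        refine Real.exp_le_exp.mpr (neg_le_neg (mul_le_mul_of_nonneg_left ?_ hβ))
        have h3 : 0 ≤ 1 - Real.cos (π / m) := by linarith [Real.cos_le_one (π / (m : ℝ))]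
        exact mul_le_mul_of_nonneg_right (by linarith) h3
      have happly : haarConv (u1W β) ((haarConv (u1W β))^[2 * j + 1] (u1W β)) u =
          ∫⁻ g, (haarConv (u1W β))^[2 * j + 1] (u1W β) (u * g) * u1W β g
            ∂(haarProbability Circle) := rfl
      rw [happly]
      calc ENNReal.ofReal (Real.exp (-(β * ((m + 1 : ℝ) * (1 - Real.cos (π / m)))))) *
            ((haarConv (u1W β))^[2 * j + 1] (u1W β) 1 * Lattice.z1 u1Rep β)
          = ∫⁻ g, ENNReal.ofReal (Real.exp (-(β * ((m + 1 : ℝ) * (1 - Real.cos (π / m)))))) *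
              (haarConv (u1W β))^[2 * j + 1] (u1W β) 1 * u1W β g ∂(haarProbability Circle) := by
            rw [z1_eq_lintegral_u1W, ← mul_assoc, ← lintegral_const_mul _ hw]
        _ ≤ ∫⁻ g, (haarConv (u1W β))^[2 * j + 1] (u1W β) (u * g) * u1W β g
              ∂(haarProbability Circle) :=
            lintegral_mono fun g => mul_le_mul_left (hρ g) _
  · -- odd `m = 2i+1`
    refine ⟨(haarConv (u1W β))^[m] (u1W β) 1, iterate_apply_ne_zero hw hw0 _ _,
      iterate_apply_le_one hw hw1 _ _, ?_, ?_⟩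
    · intro u; rw [hi]; exact iterate_odd_apply_le hw hws i u
    · intro u
      refine le_trans (mul_le_mul_left (ENNReal.ofReal_le_ofReal ?_) _) (iterate_apply_ge hβ m u)
      exact exp_comp_mono hβ (by positivity) hm1 (by linarith)

end Summit.Ventures.LatticeQCDFlow.Theory2.HaarConv

end
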